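import Literature.Barriers.Parity.SiegelZeroPrimePairsProofs
import Literature.NumberTheory.Sieve.MontgomeryVaughan1975GaussSums
import HarnessLib

/-!
# Complete character sums behind Matomäki–Merikoski's Lemma 2.5: Ramanujan-sum evaluations

Tools for `Literature/Barriers/Parity/SiegelZeroPrimePairsCharSums.lean`, which proves Lemma 2.5
((2.7)–(2.9)) of Matomäki–Merikoski, *Siegel zeros, twin primes, Goldbach's conjecture, and
primes in short intervals* (IMRN 2023; arXiv:2112.11412) — the complete character sums modulo
`q` that produce the correction factor of their Theorem 1.3
(`Literature.Barriers.Parity.MatomakiMerikoski2023_pairCorrelation`). Everything here is PROVED; the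
Ramanujan sum is the tree's Kluyver form `Literature.NumberTheory.Sieve.ramanujanDivisorSum h q
= ∑_{d ∣ (q,h)} d μ(q/d)` (`RamanujanSum.lean`).

* `sum_apply_add_mul_eq_zero` — for a PRIMITIVE character `χ` mod `q`, `b ≢ 0`:
  `∑_{x mod q} χ(c + b x) = 0` (a unit `v ≡ 1 (mod (b,q))` with `χ(v) ≠ 1` permutes the
  progression; Mathlib's `DirichletCharacter.factorsThrough_iff_ker_unitsMap`);
* `sum_range_div_apply_add` — `∑_{i < q/d} χ(c + a d i) = (q/d) χ(c) [q ∣ a d]` for `d ∣ q`;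
* `sum_range_coprime_eq_sum_divisors`, `coprime_indicator_eq_sum_divisors_ite` — Möbius inversion
  on `(j, q) = 1` over the residues `0 ≤ j < q`;
* `sum_units_apply_one_add_mul` — **`∑_{u ∈ (ℤ/q)ˣ} χ(1 + a u) = c_q(a)`** for primitive `χ`;
* `sum_apply_mul_apply_add` — **`∑_{m mod q} χ(m) χ(ε m + h) = χ(ε) c_q(h)`** for primitive
  quadratic `χ` and a unit `ε`;
* `card_units_filter_dvd_add` — `#{u ∈ (ℤ/q)ˣ : u + h ≡ 0 (d)} = [(d,h)=1] φ(q)/φ(d)` (`d ∣ q`),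
  and `sum_divisors_moebius_mul_coprime_div_totient` —
  `∑_{d ∣ q} μ(d)[(d,h)=1]/φ(d) = ∏_{p ∣ q} (1 − [(p,h)=1]/φ(p))`;
* `ramanujanDivisorSum_two_pow`, `ramanujanDivisorSum_two_pow_div`,
  `ramanujanDivisorSum_div_of_squarefree` — `c_{2^r}(h) = 2^r[2^r ∣ h] − 2^{r−1}[2^{r−1} ∣ h]`,
  `c_{2^r}(h)/2^r = 1_{2^{r−1} ∣ h}(−1)^{h/2^{r−1}}/2`, and `c_n(h)/n = ∏_{p ∣ n} c_p(h)/p` for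
  squarefree `n`.

## References

* K. Matomäki, J. Merikoski, *Siegel zeros, twin primes, Goldbach's conjecture, and primes in
  short intervals*, IMRN 2023:23, 20337–20384 (arXiv:2112.11412), Lemma 2.5 and its proof in
  §3.4 "Character sums" (statement in §2 "Initial steps"). [cite: MatomakiMerikoski2023, Lemma 2.5]
* H. L. Montgomery, R. C. Vaughan, *Multiplicative Number Theory I*, CUP 2007, Thm 4.1 (4.7)
  (Kluyver's form of `c_q(n)`; tree: `Literature.NumberTheory.Sieve.ramanujanSum_eq_ramanujanDivisorSum`).
  [cite: MontgomeryVaughan2007, Thm 4.1 eq. (4.7), p. 110]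
-/

noncomputable section

open Finset DirichletCharacter
open scoped ArithmeticFunction.Moebius

namespace Literature.Barriers.Parity.MatomakiMerikoski

open Literature.NumberTheory.Sieve Literature.NumberTheory.Sieve.MontgomeryVaughan1975

variable {q : ℕ} [NeZero q]

/-- For a PRIMITIVE character `χ` mod `q`, any `c` and `b ≢ 0 (mod q)`, the complete character
sum over the arithmetic progression `c + b x` vanishes: `∑_{x mod q} χ(c + b x) = 0`. (With
`g = (b, q) < q`, `χ` does not factor through `g`, so some unit `v ≡ 1 (mod g)` has `χ(v) ≠ 1`;
writing `v = 1 + t g` and `g = b z` (Bézout), `v (c + b x) = c + b (t c z + v x)` and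
`x ↦ t c z + v x` permutes `ℤ/q`, whence `χ(v) Σ = Σ`.) [folklore] -/
theorem sum_apply_add_mul_eq_zero (χ : DirichletCharacter ℂ q) (hχ : χ.IsPrimitive)
    (c : ZMod q) {b : ZMod q} (hb : b ≠ 0) : ∑ x : ZMod q, χ (c + b * x) = 0 := by
  set g : ℕ := Nat.gcd b.val q with hgdef
  have hbval : b.val ≠ 0 := fun h0 => hb ((ZMod.val_eq_zero b).mp h0)
  have hgq : g ∣ q := Nat.gcd_dvd_right _ _
  have hglt : g < q :=
    lt_of_le_of_lt (Nat.le_of_dvd (Nat.pos_of_ne_zero hbval) (Nat.gcd_dvd_left _ _))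
      (ZMod.val_lt b)
  have hnf : ¬ χ.FactorsThrough g := fun hF =>
    SiegelCorr.not_isPrimitive_of_factorsThrough χ hgq hglt hF hχ
  rw [factorsThrough_iff_ker_unitsMap hgq] at hnf
  obtain ⟨v, hv1, hv2⟩ : ∃ v : (ZMod q)ˣ, v ∈ (ZMod.unitsMap hgq).ker ∧ χ v ≠ 1 := by
    by_contra hall
    push Not at hall
    exact hnf fun v hv => MonoidHom.mem_ker.mpr (Units.ext (by
      rw [MulChar.coe_toUnitHom]; exact hall v hv))
  obtain ⟨t, ht⟩ := SiegelCorr.exists_eq_one_add_mul_of_mem_ker hgq hv1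
  -- Bézout: `g = b z` in `ℤ/q`
  obtain ⟨z, hz⟩ : ∃ z : ZMod q, ((g : ℕ) : ZMod q) = b * z := by
    refine ⟨(Nat.gcdA b.val q : ZMod q), ?_⟩
    have hbez := Nat.gcd_eq_gcd_ab b.val q
    have h' : ((Nat.gcd b.val q : ℕ) : ZMod q) =
        ((b.val : ℤ) * Nat.gcdA b.val q + (q : ℤ) * Nat.gcdB b.val q : ℤ) := by
      rw [← hbez, Int.cast_natCast]
    rw [hgdef, h']
    push_cast
    rw [ZMod.natCast_self, zero_mul, add_zero, ZMod.natCast_zmod_val]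
  set Z := ∑ x : ZMod q, χ (c + b * x) with hZ
  have hvZ : χ v * Z = Z := by
    rw [hZ, Finset.mul_sum]
    have hterm : ∀ x : ZMod q, χ v * χ (c + b * x) = χ (c + b * (t * c * z + v * x)) := by
      intro x
      rw [← map_mul]
      congr 1
      rw [ht]
      linear_combination t * c * hz
    simp_rw [hterm]
    exact Equiv.sum_comp ((Units.mulLeft v).trans (Equiv.addLeft (t * c * z)))
      (fun x => χ (c + b * x))
  have : (χ v - 1) * Z = 0 := by rw [sub_mul, hvZ, one_mul, sub_self]
  rcases mul_eq_zero.mp this with h | h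
  · exact absurd (sub_eq_zero.mp h) hv2
  · exact h

/-- Sums of `χ(c + a d i)` over `i < q/d` (`d ∣ q`): they equal `(q/d) χ(c)` when `q ∣ a d`
(every term is `χ(c)`) and vanish otherwise (`d` copies of the sum make up the complete sum
`∑_{x mod q} χ(c + a d x) = 0` of `sum_apply_add_mul_eq_zero`). [folklore] -/
theorem sum_range_div_apply_add (χ : DirichletCharacter ℂ q) (hχ : χ.IsPrimitive) (c : ZMod q)
    (a : ℕ) {d : ℕ} (hd : d ∣ q) :
    ∑ i ∈ range (q / d), χ (c + ((a * (d * i) : ℕ) : ZMod q)) =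
      if q ∣ a * d then ((q / d : ℕ) : ℂ) * χ c else 0 := by
  have hq0 : q ≠ 0 := NeZero.ne q
  have hd0 : d ≠ 0 := fun h => hq0 (zero_dvd_iff.mp (h ▸ hd))
  set n := q / d with hndef
  have hqn : q = n * d := by rw [hndef, Nat.div_mul_cancel hd]
  split_ifs with hdiv
  · have hterm : ∀ i ∈ range n, χ (c + ((a * (d * i) : ℕ) : ZMod q)) = χ c := by
      intro i _
      have h0 : ((a * d : ℕ) : ZMod q) = 0 := (ZMod.natCast_eq_zero_iff _ _).mpr hdiv
      rw [show a * (d * i) = (a * d) * i by ring, Nat.cast_mul, h0, zero_mul, add_zero]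
    rw [sum_congr rfl hterm, sum_const, card_range, nsmul_eq_mul]
  · -- the complete sum vanishes and equals `d` copies of ours
    have hb : ((a * d : ℕ) : ZMod q) ≠ 0 := fun h => hdiv ((ZMod.natCast_eq_zero_iff _ _).mp h)
    have hZ0 := sum_apply_add_mul_eq_zero χ hχ c hb
    rw [← sum_range_eq_sum_zmod (fun x => χ (c + ((a * d : ℕ) : ZMod q) * x))] at hZ0
    have hZ : ∑ j ∈ range (n * d), χ (c + ((a * d : ℕ) : ZMod q) * (j : ZMod q)) = 0 := by
      rw [← hqn]; exact hZ0
    rw [sum_range_mul_eq _ n d] at hZ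
    have hinner : ∀ j₀ ∈ range n, ∑ u ∈ range d,
        χ (c + ((a * d : ℕ) : ZMod q) * ((j₀ + n * u : ℕ) : ZMod q)) =
          (d : ℂ) * χ (c + ((a * (d * j₀) : ℕ) : ZMod q)) := by
      intro j₀ _
      have hterm : ∀ u ∈ range d, χ (c + ((a * d : ℕ) : ZMod q) * ((j₀ + n * u : ℕ) : ZMod q)) =
          χ (c + ((a * (d * j₀) : ℕ) : ZMod q)) := by
        intro u _
        congr 1
        have hq' : ((n * d : ℕ) : ZMod q) = 0 := by rw [← hqn, ZMod.natCast_self]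
        have : ((a * d : ℕ) : ZMod q) * ((j₀ + n * u : ℕ) : ZMod q) =
            ((a * (d * j₀) : ℕ) : ZMod q) + (a * u : ℕ) * ((n * d : ℕ) : ZMod q) := by
          push_cast; ring
        rw [this, hq', mul_zero, add_zero]
      rw [sum_congr rfl hterm, sum_const, card_range, nsmul_eq_mul]
    rw [sum_congr rfl hinner, ← mul_sum] at hZ
    have hd0' : (d : ℂ) ≠ 0 := Nat.cast_ne_zero.mpr hd0
    exact (mul_eq_zero.mp hZ).resolve_left hd0'

/-- Möbius inversion on the coprimality condition over the residues `0 ≤ j < q`: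
`∑_{j < q, (j,q)=1} F(j) = ∑_{d ∣ q} μ(d) ∑_{i < q/d} F(d i)`. [folklore] -/
theorem sum_range_coprime_eq_sum_divisors (F : ℕ → ℂ) :
    ∑ j ∈ range q, (if j.Coprime q then (1 : ℂ) else 0) * F j =
      ∑ d ∈ q.divisors, (μ d : ℂ) * ∑ i ∈ range (q / d), F (d * i) := by
  have hq0 : q ≠ 0 := NeZero.ne q
  simp_rw [coprime_indicator_eq_sum_moebius, sum_mul]
  have hswap : ∀ j ∈ range q, ∑ d ∈ (Nat.gcd j q).divisors, (μ d : ℂ) * F j =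
      ∑ d ∈ q.divisors, if d ∣ j then (μ d : ℂ) * F j else 0 := by
    intro j _
    rw [← sum_filter]
    refine sum_congr ?_ fun _ _ => rfl
    ext d
    simp only [Nat.mem_divisors, mem_filter, Nat.dvd_gcd_iff]
    constructor
    · rintro ⟨⟨hdj, hdq⟩, -⟩; exact ⟨⟨hdq, hq0⟩, hdj⟩
    · rintro ⟨⟨hdq, -⟩, hdj⟩
      exact ⟨⟨hdj, hdq⟩, Nat.gcd_ne_zero_right hq0⟩
  rw [sum_congr rfl hswap, sum_comm]
  refine sum_congr rfl fun d hd => ?_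
  have hdq : d ∣ q := Nat.dvd_of_mem_divisors hd
  have hd0 : d ≠ 0 := (Nat.pos_of_mem_divisors hd).ne'
  rw [← sum_filter, filter_range_dvd_eq_image hdq hd0, sum_image fun i _ j _ h =>
    Nat.eq_of_mul_eq_mul_left (Nat.pos_of_ne_zero hd0) h, mul_sum]

/-- **Linear character sums over the units are Ramanujan sums**: for a primitive character `χ`
mod `q` and `a ∈ ℕ`, `∑_{u ∈ (ℤ/q)ˣ} χ(1 + a u) = c_q(a) = ∑_{d ∣ (q, a)} d μ(q/d)` (Möbius
inversion on the condition `(u, q) = 1`: `∑_{d ∣ q} μ(d) ∑_{i < q/d} χ(1 + a d i)`, and the inner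
sums are `q/d · [q ∣ a d]` by `sum_range_div_apply_one_add`). [folklore] -/
theorem sum_units_apply_one_add_mul (χ : DirichletCharacter ℂ q) (hχ : χ.IsPrimitive) (a : ℕ) :
    ∑ u : (ZMod q)ˣ, χ (1 + a * u) = (ramanujanDivisorSum a q : ℂ) := by
  -- units ↦ coprime residues `j < q`
  have h1 : ∑ u : (ZMod q)ˣ, χ (1 + a * u) =
      ∑ j ∈ range q, (if j.Coprime q then (1 : ℂ) else 0) * χ (1 + a * (j : ZMod q)) := by
    have hA : ∑ u : (ZMod q)ˣ, χ (1 + a * u) =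
        ∑ x : ZMod q, (if IsUnit x then (1 : ℂ) else 0) * χ (1 + (a : ZMod q) * x) := by
      rw [← sum_units_eq_sum (fun x : ZMod q => (if IsUnit x then (1 : ℂ) else 0) * χ (1 + (a : ZMod q) * x))
        (fun x hx => by rw [if_neg hx, zero_mul])]
      refine sum_congr rfl fun u _ => ?_
      rw [if_pos (Units.isUnit u), one_mul]
    rw [hA, ← sum_range_eq_sum_zmod (fun x : ZMod q => (if IsUnit x then (1 : ℂ) else 0) * χ (1 + (a : ZMod q) * x))]
    refine sum_congr rfl fun j _ => ?_
    congr 1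
    exact if_congr (ZMod.isUnit_iff_coprime j q) rfl rfl
  rw [h1, sum_range_coprime_eq_sum_divisors (fun j => χ (1 + a * (j : ZMod q)))]
  -- inner sums over the multiples of `d`
  have h3 : ∀ d ∈ q.divisors, ∑ i ∈ range (q / d), χ (1 + a * ((d * i : ℕ) : ZMod q)) =
      if q ∣ a * d then ((q / d : ℕ) : ℂ) else 0 := by
    intro d hd
    have hdq : d ∣ q := Nat.dvd_of_mem_divisors hd
    have h := sum_range_div_apply_add χ hχ 1 a hdq
    rw [map_one, mul_one] at h
    rw [← h]
    refine sum_congr rfl fun i _ => ?_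
    push_cast; ring_nf
  rw [sum_congr rfl fun d hd => by rw [h3 d hd]]
  -- Kluyver's form
  rw [ramanujanDivisorSum_apply, Nat.sum_divisorsAntidiagonal
    (fun x y => (μ x : ℤ) * (if y ∣ a then (y : ℤ) else 0)), Int.cast_sum]
  refine sum_congr rfl fun d hd => ?_
  have hdq : d ∣ q := Nat.dvd_of_mem_divisors hd
  have hd0 : d ≠ 0 := (Nat.pos_of_mem_divisors hd).ne'
  have hiff : q ∣ a * d ↔ q / d ∣ a := by
    constructor
    · intro h
      have : q / d ∣ a * d / d := Nat.div_dvd_div hdq h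
      rwa [Nat.mul_div_cancel _ (Nat.pos_of_ne_zero hd0)] at this
    · intro h
      have := Nat.mul_dvd_mul h (dvd_refl d)
      rwa [Nat.div_mul_cancel hdq] at this
  rw [Int.cast_mul]
  by_cases h : q ∣ a * d
  · rw [if_pos h, if_pos (hiff.mp h), Int.cast_natCast]
  · rw [if_neg h, if_neg (fun h' => h (hiff.mpr h')), Int.cast_zero]

/-- **The shifted autocorrelation of a quadratic character is a Ramanujan sum**: for a primitive
quadratic character `χ` mod `q`, a unit `ε` of `ℤ/q` and `h ∈ ℕ`,
`∑_{m mod q} χ(m) χ(ε m + h) = χ(ε) c_q(h)` (for a unit `m`, `w = ε m`: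
`χ(m) χ(ε m + h) = χ(m) χ(w) χ(1 + h w⁻¹) = χ(ε) χ(m)² χ(1 + h w⁻¹)` with `χ(m)² = 1`; then
`m ↦ (ε m)⁻¹` permutes the units and `sum_units_apply_one_add_mul` applies). [folklore] -/
theorem sum_apply_mul_apply_add (χ : DirichletCharacter ℂ q) (hχ : χ.IsPrimitive)
    (hχ2 : χ.IsQuadratic) (ε : (ZMod q)ˣ) (h : ℕ) :
    ∑ m : ZMod q, χ m * χ (ε * m + h) = χ ε * (ramanujanDivisorSum h q : ℂ) := by
  rw [← sum_units_apply_one_add_mul χ hχ h, mul_sum,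
    ← sum_units_eq_sum (fun m => χ m * χ (ε * m + h))
      (fun m hm => by rw [MulChar.map_nonunit χ hm, zero_mul])]
  have key : ∀ u : (ZMod q)ˣ, χ u * χ (ε * u + h) =
      χ ε * χ (1 + h * (((ε * u)⁻¹ : (ZMod q)ˣ) : ZMod q)) := by
    intro u
    have hu2 : χ u * χ u = 1 := by
      rw [← sq, ← MulChar.pow_apply_coe, hχ2.sq_eq_one, MulChar.one_apply_coe]
    have h1 : ((ε * u : (ZMod q)ˣ) : ZMod q) * (((ε * u)⁻¹ : (ZMod q)ˣ) : ZMod q) = 1 :=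
      Units.mul_inv _
    have hw : (ε : ZMod q) * u + h =
        ((ε * u : (ZMod q)ˣ) : ZMod q) * (1 + h * (((ε * u)⁻¹ : (ZMod q)ˣ) : ZMod q)) := by
      calc (ε : ZMod q) * u + h
          = ((ε * u : (ZMod q)ˣ) : ZMod q) + h * (((ε * u : (ZMod q)ˣ) : ZMod q) *
              (((ε * u)⁻¹ : (ZMod q)ˣ) : ZMod q)) := by rw [h1, mul_one, Units.val_mul]
        _ = _ := by ring
    rw [hw, map_mul, Units.val_mul, map_mul]
    calc χ u * (χ ε * χ u * χ (1 + h * (((ε * u)⁻¹ : (ZMod q)ˣ) : ZMod q)))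
        = χ ε * (χ u * χ u) * χ (1 + h * (((ε * u)⁻¹ : (ZMod q)ˣ) : ZMod q)) := by ring
      _ = _ := by rw [hu2, mul_one]
  rw [Fintype.sum_congr _ _ key]
  exact Equiv.sum_comp ((Equiv.mulLeft ε).trans (Equiv.inv (ZMod q)ˣ))
    (fun u => χ ε * χ (1 + h * (u : ZMod q)))

/-! ### Counting units `u` with `u + h ≡ 0 (mod d)`; the sum `∑_{d ∣ q, (d,h)=1} μ(d)/φ(d)` -/

/-- The coprimality indicator through the divisors of `q`:
`[(j, q) = 1] = ∑_{d ∣ q} [d ∣ j] μ(d)`. [folklore] -/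
theorem coprime_indicator_eq_sum_divisors_ite (j : ℕ) :
    (if j.Coprime q then (1 : ℂ) else 0) = ∑ d ∈ q.divisors, if d ∣ j then (μ d : ℂ) else 0 := by
  have hq0 : q ≠ 0 := NeZero.ne q
  rw [coprime_indicator_eq_sum_moebius, ← sum_filter]
  refine sum_congr ?_ fun _ _ => rfl
  ext d
  simp only [Nat.mem_divisors, mem_filter, Nat.dvd_gcd_iff]
  constructor
  · rintro ⟨⟨hdj, hdq⟩, -⟩; exact ⟨⟨hdq, hq0⟩, hdj⟩
  · rintro ⟨⟨hdq, -⟩, hdj⟩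
    exact ⟨⟨hdj, hdq⟩, Nat.gcd_ne_zero_right hq0⟩

/-- For `d ∣ q`: the units `u` mod `q` with `u + h ≡ 0 (mod d)` number `φ(q)/φ(d)` if `(d, h) = 1`
(they form a fibre of `(ℤ/q)ˣ → (ℤ/d)ˣ`, over `−h`) and `0` otherwise (`−h` is then not a unit
mod `d`). [folklore] -/
theorem card_units_filter_dvd_add {d : ℕ} (hd : d ∣ q) (h : ℕ) :
    ((Finset.univ : Finset (ZMod q)ˣ).filter (fun u : (ZMod q)ˣ => d ∣ ((u : ZMod q) + h).val)).card =
      if d.Coprime h then Nat.totient q / Nat.totient d else 0 := by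
  have hq0 : q ≠ 0 := NeZero.ne q
  have hd0 : d ≠ 0 := fun h0 => hq0 (zero_dvd_iff.mp (h0 ▸ hd))
  haveI : NeZero d := ⟨hd0⟩
  -- the condition `d ∣ (u + h).val` in terms of the image of `u` in `(ℤ/d)ˣ`
  have hkey : ∀ u : (ZMod q)ˣ, d ∣ ((u : ZMod q) + h).val ↔
      ((ZMod.unitsMap hd u : (ZMod d)ˣ) : ZMod d) = -(h : ZMod d) := by
    intro u
    rw [← ZMod.natCast_eq_zero_iff, ZMod.natCast_val, ZMod.cast_add hd, ZMod.cast_natCast hd,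
      ZMod.unitsMap_val, add_eq_zero_iff_eq_neg]
  by_cases hcop : d.Coprime h
  · rw [if_pos hcop]
    set y : (ZMod d)ˣ := ZMod.unitOfCoprime h (Nat.coprime_comm.mp hcop) with hy
    have hyval : ((-y : (ZMod d)ˣ) : ZMod d) = -(h : ZMod d) := by
      rw [Units.val_neg, hy, ZMod.coe_unitOfCoprime]
    have hfilter : (Finset.univ : Finset (ZMod q)ˣ).filter (fun u : (ZMod q)ˣ => d ∣ ((u : ZMod q) + h).val) =
        (Finset.univ : Finset (ZMod q)ˣ).filter (fun u : (ZMod q)ˣ => ZMod.unitsMap hd u = -y) := by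
      refine Finset.filter_congr fun u _ => ?_
      rw [hkey, Units.ext_iff, hyval]
    rw [hfilter]
    have hcard := card_fiber_mul_totient hd (-y) (q := q)
    have hφd : 0 < Nat.totient d := Nat.totient_pos.mpr (Nat.pos_of_ne_zero hd0)
    exact (Nat.div_eq_of_eq_mul_left hφd hcard.symm).symm
  · rw [if_neg hcop, Finset.card_eq_zero, Finset.filter_eq_empty_iff]
    intro u _ hu
    rw [hkey] at hu
    apply hcop
    have hunit : IsUnit ((h : ℕ) : ZMod d) := by
      have : ((h : ℕ) : ZMod d) = ((-(ZMod.unitsMap hd u) : (ZMod d)ˣ) : ZMod d) := by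
        rw [Units.val_neg, hu, neg_neg]
      rw [this]
      exact Units.isUnit _
    exact Nat.coprime_comm.mp ((ZMod.isUnit_iff_coprime h d).mp hunit)

/-- `∑_{d ∣ q} μ(d) [(d,h)=1]/φ(d) = ∏_{p ∣ q} (1 − [(p,h)=1]/φ(p))` (only squarefree `d`
contribute, so the sum lives on the divisors of the radical `∏_{p ∣ q} p`, where it is the Euler
product of the multiplicative function `d ↦ [(d,h)=1]/φ(d)`). [folklore] -/
theorem sum_divisors_moebius_mul_coprime_div_totient (h : ℕ) :
    ∑ d ∈ q.divisors, (μ d : ℂ) * (if d.Coprime h then 1 / (Nat.totient d : ℂ) else 0) =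
      ∏ p ∈ q.primeFactors, (1 - if p.Coprime h then 1 / (Nat.totient p : ℂ) else 0) := by
  have hq0 : q ≠ 0 := NeZero.ne q
  -- the weight as a multiplicative arithmetic function
  set w : ArithmeticFunction ℂ :=
    ⟨fun d => if d = 0 then 0 else if d.Coprime h then 1 / (Nat.totient d : ℂ) else 0, if_pos rfl⟩
    with hwdef
  have hw_apply : ∀ {d : ℕ}, d ≠ 0 → w d = if d.Coprime h then 1 / (Nat.totient d : ℂ) else 0 := by
    intro d hd
    rw [hwdef, ArithmeticFunction.coe_mk, if_neg hd]
  have hw : w.IsMultiplicative := by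
    refine ⟨by rw [hw_apply one_ne_zero, if_pos (Nat.coprime_one_left h)]; simp, fun {m n} hmn => ?_⟩
    rcases Nat.eq_zero_or_pos m with rfl | hm
    · simp [hwdef]
    rcases Nat.eq_zero_or_pos n with rfl | hn
    · simp [hwdef]
    rw [hw_apply (Nat.mul_ne_zero hm.ne' hn.ne'), hw_apply hm.ne', hw_apply hn.ne',
      Nat.totient_mul hmn, Nat.cast_mul]
    by_cases hmh : m.Coprime h <;> by_cases hnh : n.Coprime h
    · rw [if_pos (Nat.coprime_mul_iff_left.mpr ⟨hmh, hnh⟩), if_pos hmh, if_pos hnh]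
      rw [one_div_mul_one_div]
    · rw [if_neg (fun hc => hnh (Nat.coprime_mul_iff_left.mp hc).2), if_pos hmh, if_neg hnh,
        mul_zero]
    · rw [if_neg (fun hc => hmh (Nat.coprime_mul_iff_left.mp hc).1), if_neg hmh, zero_mul]
    · rw [if_neg (fun hc => hmh (Nat.coprime_mul_iff_left.mp hc).1), if_neg hmh, zero_mul]
  -- restate through `w`
  rw [sum_congr rfl fun d hd => by rw [← hw_apply (Nat.pos_of_mem_divisors hd).ne'],
    prod_congr rfl fun p hp => by rw [← hw_apply (Nat.prime_of_mem_primeFactors hp).ne_zero]]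
  -- the radical
  set R := ∏ p ∈ q.primeFactors, p with hR
  have hRdvd : R ∣ q := Nat.prod_primeFactors_dvd q
  have hRsq : Squarefree R := by
    refine Finset.squarefree_prod_of_pairwise_isCoprime ?_ fun p hp =>
      (Nat.prime_of_mem_primeFactors hp).prime.squarefree
    intro a ha b hb hab
    exact Nat.coprime_iff_isRelPrime.mp
      ((Nat.coprime_primes (Nat.prime_of_mem_primeFactors ha)
        (Nat.prime_of_mem_primeFactors hb)).mpr hab)
  have hRpf : R.primeFactors = q.primeFactors := Nat.primeFactors_prod_primeFactors q
  rw [← hRpf, hw.prodPrimeFactors_one_sub_of_squarefree _ hRsq]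
  symm
  refine Finset.sum_subset (Nat.divisors_subset_of_dvd hq0 hRdvd) fun d hd hdR => ?_
  have hdq : d ∣ q := Nat.dvd_of_mem_divisors hd
  have hnsq : ¬ Squarefree d := by
    intro hsq
    apply hdR
    rw [Nat.mem_divisors]
    refine ⟨?_, hRsq.ne_zero⟩
    rw [← Nat.prod_primeFactors_of_squarefree hsq, hR]
    exact Finset.prod_dvd_prod_of_subset _ _ _ (Nat.primeFactors_mono hdq hq0)
  rw [ArithmeticFunction.moebius_eq_zero_of_not_squarefree hnsq, Int.cast_zero, zero_mul]

/-! ### The Ramanujan sum `c_q(h)/q` for `q = 2^r q'`, `q'` squarefree, `h` even -/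

/-- `c_{2^r}(h) = 2^r [2^r ∣ h] − 2^{r−1} [2^{r−1} ∣ h]` for `r ≥ 1` (Kluyver's form; only `d = 1, 2`
have `μ(d) ≠ 0`). [folklore] -/
theorem ramanujanDivisorSum_two_pow (h : ℕ) {r : ℕ} (hr : 1 ≤ r) :
    ramanujanDivisorSum h (2 ^ r) =
      (if 2 ^ r ∣ h then ((2 ^ r : ℕ) : ℤ) else 0) -
        (if 2 ^ (r - 1) ∣ h then ((2 ^ (r - 1) : ℕ) : ℤ) else 0) := by
  rw [ramanujanDivisorSum_apply, Nat.sum_divisorsAntidiagonal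
    (fun x y => (μ x : ℤ) * (if y ∣ h then (y : ℤ) else 0)),
    Nat.sum_divisors_prime_pow Nat.prime_two]
  obtain ⟨k, rfl⟩ : ∃ k, r = k + 1 := ⟨r - 1, by omega⟩
  rw [Finset.sum_range_succ', Finset.sum_range_succ']
  have hrest : ∑ i ∈ range k, (μ (2 ^ (i + 1 + 1)) : ℤ) *
      (if 2 ^ (k + 1) / 2 ^ (i + 1 + 1) ∣ h then ((2 ^ (k + 1) / 2 ^ (i + 1 + 1) : ℕ) : ℤ) else 0) = 0 := by
    refine Finset.sum_eq_zero fun i _ => ?_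
    rw [ArithmeticFunction.moebius_apply_prime_pow Nat.prime_two (by omega), if_neg (by omega),
      zero_mul]
  rw [hrest, zero_add, pow_zero, Nat.div_one, ArithmeticFunction.moebius_apply_one, one_mul,
    pow_one, ArithmeticFunction.moebius_apply_prime Nat.prime_two, Nat.add_sub_cancel,
    pow_succ, Nat.mul_div_cancel _ two_pos]
  ring

/-- For even `h` and `r ≥ 1`: `c_{2^r}(h)/2^r = 1_{2^{r−1} ∣ h} (−1)^{h/2^{r−1}} / 2` (the
"expression in the parentheses" of the source, §3.4: `2^r 1_{2^r ∣ h} − 2^{r−1} 1_{2^{r−1} ∣ h}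
= 2^{r−1} 1_{2^{r−1} ∣ h} (−1)^{h/2^{r−1}}`). [cite: MatomakiMerikoski2023, proof of Lemma 2.5 (§3.4)] -/
theorem ramanujanDivisorSum_two_pow_div (h : ℕ) {r : ℕ} (hr : 1 ≤ r) :
    (ramanujanDivisorSum h (2 ^ r) : ℂ) / (2 : ℂ) ^ r =
      (if 2 ^ (r - 1) ∣ h then (-1 : ℂ) ^ (h / 2 ^ (r - 1)) else 0) / 2 := by
  rw [ramanujanDivisorSum_two_pow h hr]
  have h2r : (2 : ℂ) ^ r = 2 * (2 : ℂ) ^ (r - 1) := by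
    rw [← pow_succ']; congr 1; omega
  have hpow : ((2 ^ (r - 1) : ℕ) : ℂ) = (2 : ℂ) ^ (r - 1) := by push_cast; ring
  have hpow' : ((2 ^ r : ℕ) : ℂ) = (2 : ℂ) ^ r := by push_cast; ring
  have hne : (2 : ℂ) ^ (r - 1) ≠ 0 := pow_ne_zero _ two_ne_zero
  by_cases hd : 2 ^ (r - 1) ∣ h
  · obtain ⟨k, hk⟩ := hd
    have hd' : 2 ^ (r - 1) ∣ h := ⟨k, hk⟩
    have hkdiv : h / 2 ^ (r - 1) = k := by
      rw [hk, Nat.mul_div_cancel_left _ (Nat.pos_of_ne_zero (pow_ne_zero _ two_ne_zero))]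
    simp only [if_pos hd', hkdiv]
    by_cases hk2 : Even k
    · have hdr : 2 ^ r ∣ h := by
        obtain ⟨j, rfl⟩ := hk2
        refine ⟨j, ?_⟩
        rw [hk, ← two_mul, ← mul_assoc, ← pow_succ]
        congr 2; omega
      rw [if_pos hdr, hk2.neg_one_pow]
      push_cast
      rw [h2r]
      field_simp
      ring
    · have hodd : Odd k := Nat.not_even_iff_odd.mp hk2
      have hdr : ¬ 2 ^ r ∣ h := by
        rintro ⟨j, hj⟩
        apply hk2
        refine ⟨j, ?_⟩
        have : 2 ^ (r - 1) * k = 2 ^ (r - 1) * (j + j) := by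
          rw [← hk, hj, ← two_mul, ← mul_assoc, ← pow_succ]
          congr 2; omega
        exact Nat.eq_of_mul_eq_mul_left (Nat.pos_of_ne_zero (pow_ne_zero _ two_ne_zero)) this
      rw [if_neg hdr, hodd.neg_one_pow]
      push_cast
      rw [h2r]
      field_simp
      ring
  · have hdr : ¬ 2 ^ r ∣ h := fun h' => hd ((pow_dvd_pow 2 (Nat.sub_le r 1)).trans h')
    simp only [if_neg hd, if_neg hdr]
    simp

/-- For squarefree `n`: `c_n(h)/n = ∏_{p ∣ n} c_p(h)/p = ∏_{p ∣ (n,h)} (1 − 1/p) ∏_{p ∣ n, p ∤ h} (−1/p)`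
(multiplicativity and the prime values `c_p(h) = p − 1` or `−1`). [folklore] -/
theorem ramanujanDivisorSum_div_of_squarefree (h : ℕ) {n : ℕ} (hn : Squarefree n) :
    (ramanujanDivisorSum h n : ℂ) / n =
      ∏ p ∈ n.primeFactors, (if p ∣ h then (1 - 1 / (p : ℂ)) else (-1 / (p : ℂ))) := by
  have hmult := isMultiplicative_ramanujanDivisorSum h
  conv_lhs => rw [← Nat.prod_primeFactors_of_squarefree hn]
  rw [hmult.map_prod_of_subset_primeFactors n n.primeFactors Finset.Subset.rfl,
    Int.cast_prod, Nat.cast_prod, ← Finset.prod_div_distrib]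
  refine Finset.prod_congr rfl fun p hp => ?_
  have hpr := Nat.prime_of_mem_primeFactors hp
  have hp0 : (p : ℂ) ≠ 0 := Nat.cast_ne_zero.mpr hpr.ne_zero
  rw [ramanujanDivisorSum_prime h hpr]
  split_ifs
  · push_cast; field_simp
  · push_cast; ring

end Literature.Barriers.Parity.MatomakiMerikoski

end
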